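import Literature.AnabelianGeometry.EtaleTheta.ArithThetaTowerFrobenioidLaws
import Literature.IUT.HodgeTheaters.GenuineFKitOfBadLocalTemperedArith

/-!
# Kernel DAG index — layer X = MIXED delta (L5 ×1; one file per cycle under the live-queue discipline); 1 DISCHARGE SIBLINGS `N_<id>'` — rule DSIB-1 (abc-iut-dag GO 2026-08-27T19:22:42Z, guards (a)–(g)): for a DATA node of a claim-kind row marked discharged(p…) the sibling binds, BY NAME, the theorems of the lead-designated proof module(s) — the p-id(s) of that token — whose CONCLUSION HEAD is the node's typed statement def (farm scan, ProducersScan conclusion-head rule; FACT-minimal choice per def: assumption-free dischargers preferred, others enter only when none exists and then their F-ids are named; conjuncts without discharger are listed and NOT claimed). A conclusion-head match is a kernel fact about the TYPED statement; whether a discharger discharges the PRINTED item is the referees' and leads' word (RQ7/REF passes, NODES.md), not this file's. Append-only: the data node stays; dag re-keys col 21 to the primed name, part zj (GENERATED by abc-iut-c312-2 gen 11 `work/gen_index.py` @2026-08-29T00:43Z from HOME/plan/DAG.tsv +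
KERNEL-DAG-MODULES.tsv (regenerated 2026-08-29T00:02:09Z): 1 landed/discharged nodes NOT YET in the tree index Summits/ABC/IUTFork/DAG*.lean; spec v1.3 §2 (M))

THIS FILE PROVES NOTHING NEW AND ASSERTS NOTHING (HOME/plan/KERNEL-DAG-SPEC.md). It gives ONE NAME `N_<kernel_id>` to each DAG node whose
statement has LANDED through the gate, knitting the landed declarations BY NAME: claim nodes `N_<id> : Prop := StatementOf @thm₁ ∧ …` (one
conjunct per landed theorem the DAG row names, universe levels instantiated explicitly per the spec's UNIVERSE RULE, arities read off the farm),
witnessed `N_<id>_holds` iff the DAG row is `discharged(p…)` and `N_<id>_part` otherwise (spec §2(b),(c); c312-2 F1/F2); data nodes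
`abbrev N_<id> := @<primary>` with the row's further declarations as `example := @…` lines; FACT-style `def … : Prop` declarations are data
here (a NAME, never asserted). Decl lists come from the `decls` column of plan/DAG.tsv as resolved against the tree sources (unresolvable
tokens dropped and reported to abc-iut-dag on STATUS). Nothing here says abc is proved or refuted or takes a side on [IUTchIII] Cor 3.12.
typed ≠ discharged; indexed ≠ endorsed.
-/

namespace Summit.ABC.IUTFork.DAG

namespace PartXzj
/-- `StatementOf h` is the statement (a `Prop`) of which the landed `h` is the proof: the index NAMES statements, it never re-types them. -/
abbrev StatementOf {P : Prop} (_h : P) : Prop := P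
end PartXzj
open PartXzj

noncomputable section
universe u₁ u₂ u₃ u₄ u₅ u₆ u₇ u₈ u₉ u₁₀ u₁₁ u₁₂ u₁₃ u₁₄ u₁₅ u₁₆


/-- [node IUTchI:Ex3.2(i) · L5/D2 · [IUTchI] Ex 3.2 (i), kurims p.69 · p679494 · claim · DAG status discharged(p679494+p666763+p667500)] decls 6 · DISCHARGE SIBLING of the data node `N_IUTchI_Ex3_2_i` (which binds the item's typed STATEMENT def): this sibling binds the theorems of the lead-designated proof module(s) — the p-id(s) of the row's own discharged(…) token — whose CONCLUSION HEAD is that statement (farm scan, ProducersScan conclusion-head rule; STANDING RULE DSIB-S (abc-iut-dag g8 2026-08-28T02:18:32Z + erratum 02:18:49Z): the chair's one line = designation + no-strike; filed ≥ 30 min after it; designation (β) = abc-iut-L5-lead g16 RULINGS #376 2026-08-29T00:12:40Z VERBATIM: «DSIB IUTchI:Ex3.2(i): dischargers = InitialThetaData.badTemperedRestArith, InitialThetaData.badTemperedRestArith_Fr, InitialThetaData.nonempty_badTemperedRestBirat @p679494; ArithThetaTower.temperedFrobenioid, ArithThetaTower.isFrobenioid_temperedFrobenioid, ArithThetaTower.carrierSpec_temperedFrobenioid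 @p675527; own = InitialThetaData.BadTemperedRestBirat» (A-token flip IUTchI:Ex3.2(i) landed→discharged(p679494+p666763+p667500), dag tick #66 2026-08-29T00:02:09Z)); append-only; dag: kernel_id := `N_IUTchI_Ex3_2_i'` · conjuncts NOT covered (bound statement defs with no discharger in the designated module(s); nothing claimed about them): `BadLocalFrobenioid`, `conjMaps`, `thetaOrbit`, `BiratFromF`, `BasesFromC`, `FthetaFromF`, `FdashFromC` · designated proof p-ids p679494,p675527 · the item's OWN statement def(s): `BadTemperedRestBirat` (chair (β) designation RULINGS #376 «own = InitialThetaData.BadTemperedRestBirat» (the node's index alias `BadLocalFrobenioid` is a STRUCTURE and its field Props have no conclusion-head theorem in the token's modules — the discharging objects are CONSTRUCTIONS; guard (c) satisfied by the chair's word, not by docstring)) · the decl list is EXACTLY the chair's (β) list (= CONE v2.18/v2.19 row Ex3.2(i) «discharging decls» of record + read-outs + NV): defs `badTemperedRestArith` (THE GENUINE (m1) knit, GA-07 ★ p679494) and `ArithThetaTower.temperedFrobenioid` (GA-12 ★ p675527) bound as alias/`example` lines, theorems `badTemperedRestArith_Fr` (rfl: `Fr = temperedFrobenioid (D.gvdAt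 x _) T`), `nonempty_badTemperedRestBirat` (NV), `isFrobenioid_temperedFrobenioid`, `carrierSpec_temperedFrobenioid` as StatementOf conjuncts; `ConstTower.ofGaloisValDatum` (GA-01) not added (chair: optional); discharged-at-our-typed-spec ≠ print's ℱ̲_v of an actual Tate curve ≠ proved-in-print; count-neutral · HONEST FRAMING: dischargers = OUR theorems about OUR typed statement, proved at our data / at a model where the designated module says so; discharged-at-our-data ≠ endorsed ≠ proved-in-print; census of record for the printed item = plan/L5/NODES.md; no side taken on [IUTchIII] Cor 3.12 · decl list as NAMED BY THE AUDITOR/LEAD (forced, not re-resolved) · cites→ IUTchI:Def3.1,IUTchI:Rmk3.2.1,IUTchI:Rmk3.2.2,IUTchI:Rmk3.2.3,IUTchI:Rmk3.2.4 -/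
def N_IUTchI_Ex3_2_i' : Prop :=
  StatementOf @Literature.IUT.HodgeTheaters.InitialThetaData.badTemperedRestArith_Fr ∧
  StatementOf @Literature.IUT.HodgeTheaters.InitialThetaData.nonempty_badTemperedRestBirat ∧
  StatementOf @Literature.AnabelianGeometry.EtaleTheta.ArithThetaTower.isFrobenioid_temperedFrobenioid ∧
  StatementOf @Literature.AnabelianGeometry.EtaleTheta.ArithThetaTower.carrierSpec_temperedFrobenioid
/-- discharge of `N_IUTchI_Ex3_2_i'`: the landed theorems it names, BY NAME (spec §2(c)); proves nothing new. -/
theorem N_IUTchI_Ex3_2_i'_holds : N_IUTchI_Ex3_2_i' := ⟨@Literature.IUT.HodgeTheaters.InitialThetaData.badTemperedRestArith_Fr, @Literature.IUT.HodgeTheaters.InitialThetaData.nonempty_badTemperedRestBirat, @Literature.AnabelianGeometry.EtaleTheta.ArithThetaTower.isFrobenioid_temperedFrobenioid, @Literature.AnabelianGeometry.EtaleTheta.ArithThetaTower.carrierSpec_temperedFrobenioid⟩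
example := @Literature.IUT.HodgeTheaters.InitialThetaData.badTemperedRestArith
example := @Literature.AnabelianGeometry.EtaleTheta.ArithThetaTower.temperedFrobenioid

end

end Summit.ABC.IUTFork.DAG
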